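import Literature.NumberTheory.Transcendental.BrownawellIntermittentProofs
import Literature.NumberTheory.Transcendental.NesterenkoEliminationProp411Holds
import HarnessLib

/-!
# Discharges of named facts of `BrownawellIntermittent.lean`

`Literature/NumberTheory/Transcendental/BrownawellIntermittentHolds.lean` — proofs-only
sibling of `BrownawellIntermittent.lean` (no definitions, no named facts). Each theorem below
closes a named fact `X : Prop` of that file as `X_holds : X` by composing an ACCEPTED
reduction theorem of the tree with the ACCEPTED unconditional `_holds` discharges of all of
its hypotheses; nothing is re-proved and no statement is changed. Recorded by the librarian
sweep g25 (2026-08-16, pass 5c: facts dischargeable in one line from the tree's own lemmas),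
so that the facts census, `#h21_route_deps` and the cone guardrail see these facts as
theorems.

Discharged here:

* `Brownawell1987_thm_6_2_exp_holds` := `Brownawell1987_thm_6_2_exp_of_prop_4_11`
  `NesterenkoPhilippon2001_ch3_prop_4_11_holds` (`BrownawellIntermittentProofs.lean`).

## References

* [Brownawell1987] — see `lean/references.bib` and the docstring of the fact in `BrownawellIntermittent.lean`.
-/

namespace Literature.NumberTheory.Transcendental

/-- **Discharge of the named fact `Brownawell1987_thm_6_2_exp`** (`BrownawellIntermittent.lean`):
Brownawell 1987, Theorem 6.2 — exponential case `ω = (e^{uᵢvⱼ})`, `Δ = mn/(m+n)`. Printed: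
"THEOREM 6.2. Let `0 < ε < 1/24`. … — obtained as `Brownawell1987_thm_6_2_exp_of_prop_4_11`
applied to the tree's unconditional discharge `NesterenkoPhilippon2001_ch3_prop_4_11_holds` of
its hypothesis (reduction in `BrownawellIntermittentProofs.lean`).
[cite: Brownawell1987, Theorem 6.2 (exponential case, Δ = mn/(m+n))] -/
theorem Brownawell1987_thm_6_2_exp_holds :
    Brownawell1987_thm_6_2_exp :=
  Brownawell1987_thm_6_2_exp_of_prop_4_11
    Literature.NumberTheory.Transcendental.Nesterenko.NesterenkoPhilippon2001_ch3_prop_4_11_holds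

end Literature.NumberTheory.Transcendental
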